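import Summits.KontsevichZagierPeriods.KontsevichZagierPeriods.Theses.FurushoPentagon
import Literature.NumberTheory.Transcendental.KZCubicalCalculus
import Literature.NumberTheory.Transcendental.AyoubPeriodSeries
import Literature.NumberTheory.Transcendental.AyoubPeriodSeriesPiAlgebraic
import Literature.NumberTheory.Transcendental.AyoubPeriodSeriesKernel
import Mathlib.RingTheory.MvPowerSeries.Rename
import Mathlib.Analysis.Complex.Basic

/-!
# `SectorToKernel`, line `effective-cube-surjection`: realification of a `ℚ`-combination of
Stokes elements (helper `rsf_realify` for `stub_realStokesForm`)

Helper R of the lead's assembly of `stub_realStokesForm` (crux `FurushoPentagon.SectorToKernel`,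
stmt-KontsevichZagierPeriods-10813). Ayoub's `𝒪_{ℚ-alg}(𝔻̄^∞)` (`AyoubRel.Oan (Rat.castHom ℂ)`)
consists of COMPLEX power series `G ∈ ℂ[[z₀, z₁, …]]` in finitely many variables, of polyradius of
convergence `> 1`, algebraic over `ℚ(z)`; the type (a) operator (Stokes element) is
`relAC i G = ∂G/∂zᵢ - G|_{zᵢ=1} + G|_{zᵢ=0}`. The Kontsevich–Zagier side of the crux works with REAL
functions, so a real series `Fc` (all coefficients real) written as a `ℚ`-combination
`Fc = Σⱼ cⱼ • relAC (i j) (G j)` of Stokes elements of complex `G j ∈ 𝒪_{ℚ-alg}(𝔻̄^∞)` has to be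
rewritten with series having real coefficients. We prove:

* `rre_conj_mem_Oan`: `𝒪_{ℚ-alg}(𝔻̄^∞)` is stable under coefficientwise complex conjugation
  `Ḡ := MvPowerSeries.map conj G` (same variables, same majorant since `‖conj z‖ = ‖z‖`, and the
  conjugate of a polynomial relation over `ℚ[z]` is a polynomial relation over `ℚ[z]`, as `conj`
  fixes `ℚ` and the variables);
* hence `(cⱼ/2) • (G j + conj (G j)) ∈ 𝒪_{ℚ-alg}(𝔻̄^∞)` (`cⱼ/2 ∈ ℚ` is algebraic over `ℚ`);
* `rre_relAC_conj`, `rre_relAC_add`: the Stokes operator commutes with conjugation (the constants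
  `0`, `1` of the restrictions are real) and is additive on series with absolutely summable
  coefficients (the restriction `G|_{zᵢ=1}` is a convergent sum);
* `rsf_realify`: consequently `Fc = ½ (Fc + conj Fc) = Σⱼ relAC (i j) ((cⱼ/2) • (G j + conj (G j)))`.

References: J. Ayoub, *La version relative de la conjecture des périodes de Kontsevich–Zagier
revisitée*, note (Univ. Zürich) = Tohoku Math. J. (2) 71 (2019), §1.1 and Théorème 1.1 (a)
(`AyoubRelKZRevisited`); the statements here are elementary bookkeeping (folklore).
-/

noncomputable section

namespace Summit.KontsevichZagierPeriods.FurushoPentagon.SectorToKernel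

open Set MeasureTheory
open Literature.NumberTheory.Transcendental
open Literature.NumberTheory.Transcendental.KZ hiding cubicalSpan
open Summit.KontsevichZagierPeriods.KontsevichZagierPeriods.Theses.FurushoPentagon
open AyoubRel (CSeries Oan intC relAC pdz restrC kSpan DependsOnlyOnLT HasPolyradiusGtOne
  IsAlgebraicOverRatFunc)

/-! ## Coefficients of the Stokes operator -/

/-- Coefficients of `∂F/∂zᵢ` (definitional). [folklore] -/
theorem rre_coeff_pdz (i : ℕ) (F : CSeries) (a : ℕ →₀ ℕ) :
    MvPowerSeries.coeff a (pdz i F) =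
      ((a i : ℂ) + 1) * MvPowerSeries.coeff (a + Finsupp.single i 1) F :=
  -- adapted from the S6 scratch `AyoubEffectiveCubeKernel.lean` (`coeff_pdz`)
  rfl

/-- Coefficients of `F|_{zᵢ = c}` (definitional). [folklore] -/
theorem rre_coeff_restrC (i : ℕ) (c : ℂ) (F : CSeries) (a : ℕ →₀ ℕ) :
    MvPowerSeries.coeff a (restrC i c F) =
      if a i = 0 then ∑' n : ℕ, MvPowerSeries.coeff (a + Finsupp.single i n) F * c ^ n else 0 :=
  -- adapted from the S6 scratch `AyoubEffectiveCubeKernel.lean` (`coeff_restrC`)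
  rfl

/-! ## The Stokes operator commutes with coefficientwise complex conjugation -/

/-- `∂(conj F)/∂zᵢ = conj (∂F/∂zᵢ)` (the factor `aᵢ + 1` is real). [folklore] -/
theorem rre_pdz_conj (i : ℕ) (F : CSeries) :
    pdz i (MvPowerSeries.map (starRingEnd ℂ) F) =
      MvPowerSeries.map (starRingEnd ℂ) (pdz i F) := by
  refine MvPowerSeries.ext fun a => ?_
  rw [MvPowerSeries.coeff_map, rre_coeff_pdz, rre_coeff_pdz, MvPowerSeries.coeff_map]
  simp only [map_mul, map_add, map_one, map_natCast]

/-- `(conj F)|_{zᵢ = c} = conj (F|_{zᵢ = c})` for a REAL constant `c` (conjugation is a continuous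
additive self-equivalence of `ℂ`, so it commutes with every `tsum`). [folklore] -/
theorem rre_restrC_conj (i : ℕ) {c : ℂ} (hc : starRingEnd ℂ c = c) (F : CSeries) :
    restrC i c (MvPowerSeries.map (starRingEnd ℂ) F) =
      MvPowerSeries.map (starRingEnd ℂ) (restrC i c F) := by
  refine MvPowerSeries.ext fun a => ?_
  rw [MvPowerSeries.coeff_map, rre_coeff_restrC, rre_coeff_restrC]
  split_ifs with h
  · rw [Complex.conj_tsum]
    refine tsum_congr fun n => ?_
    rw [map_mul, map_pow, hc, MvPowerSeries.coeff_map]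
  · rw [map_zero]

/-- **The Stokes operator commutes with conjugation**:
`relAC i (conj F) = conj (relAC i F)` (the restriction constants `1`, `0` are real).
[AyoubRelKZRevisited, Théorème 1.1 (a); folklore] -/
theorem rre_relAC_conj (i : ℕ) (F : CSeries) :
    relAC i (MvPowerSeries.map (starRingEnd ℂ) F) =
      MvPowerSeries.map (starRingEnd ℂ) (relAC i F) := by
  rw [relAC, relAC, rre_pdz_conj, rre_restrC_conj i (map_one (starRingEnd ℂ)) F,
    rre_restrC_conj i (map_zero (starRingEnd ℂ)) F, map_add, map_sub]

/-! ## Additivity of the Stokes operator on absolutely summable series -/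

/-- `∂(A + B)/∂zᵢ = ∂A/∂zᵢ + ∂B/∂zᵢ`. [folklore] -/
theorem rre_pdz_add (i : ℕ) (A B : CSeries) : pdz i (A + B) = pdz i A + pdz i B := by
  refine MvPowerSeries.ext fun a => ?_
  rw [map_add, rre_coeff_pdz, rre_coeff_pdz, rre_coeff_pdz, map_add, mul_add]

/-- Along the ray `a + n eᵢ` the coefficients of an absolutely summable series, weighted by `cⁿ`
with `‖c‖ ≤ 1`, are summable (the sum defining `A|_{zᵢ = c}` converges). [folklore] -/
theorem rre_summable_ray {A : CSeries}
    (hA : Summable fun a : ℕ →₀ ℕ => ‖MvPowerSeries.coeff a A‖) (a : ℕ →₀ ℕ) (i : ℕ) {c : ℂ}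
    (hc : ‖c‖ ≤ 1) :
    Summable fun n : ℕ => MvPowerSeries.coeff (a + Finsupp.single i n) A * c ^ n := by
  have hinj : Function.Injective fun n : ℕ => a + Finsupp.single i n := by
    intro m m' h
    have h' := DFunLike.congr_fun h i
    simpa using h'
  have h1 : Summable fun n : ℕ => ‖MvPowerSeries.coeff (a + Finsupp.single i n) A‖ :=
    hA.comp_injective hinj
  refine Summable.of_norm_bounded h1 fun n => ?_
  rw [norm_mul, norm_pow]
  exact mul_le_of_le_one_right (norm_nonneg _) (pow_le_one₀ (norm_nonneg _) hc)

/-- `(A + B)|_{zᵢ = c} = A|_{zᵢ = c} + B|_{zᵢ = c}` for absolutely summable `A`, `B` and `‖c‖ ≤ 1`.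
[folklore] -/
theorem rre_restrC_add (i : ℕ) {c : ℂ} (hc : ‖c‖ ≤ 1) {A B : CSeries}
    (hA : Summable fun a : ℕ →₀ ℕ => ‖MvPowerSeries.coeff a A‖)
    (hB : Summable fun a : ℕ →₀ ℕ => ‖MvPowerSeries.coeff a B‖) :
    restrC i c (A + B) = restrC i c A + restrC i c B := by
  refine MvPowerSeries.ext fun a => ?_
  rw [map_add, rre_coeff_restrC, rre_coeff_restrC, rre_coeff_restrC]
  split_ifs with h
  · rw [← (rre_summable_ray hA a i hc).tsum_add (rre_summable_ray hB a i hc)]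
    refine tsum_congr fun n => ?_
    rw [map_add, add_mul]
  · rw [add_zero]

/-- **Additivity of the Stokes operator** on series with absolutely summable coefficients:
`relAC i (A + B) = relAC i A + relAC i B`. [AyoubRelKZRevisited, Théorème 1.1 (a); folklore] -/
theorem rre_relAC_add (i : ℕ) {A B : CSeries}
    (hA : Summable fun a : ℕ →₀ ℕ => ‖MvPowerSeries.coeff a A‖)
    (hB : Summable fun a : ℕ →₀ ℕ => ‖MvPowerSeries.coeff a B‖) :
    relAC i (A + B) = relAC i A + relAC i B := by
  rw [relAC, relAC, relAC, rre_pdz_add, rre_restrC_add i norm_one.le hA hB,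
    rre_restrC_add i (by simp) hA hB]
  abel

/-! ## `𝒪_{ℚ-alg}(𝔻̄^∞)` is stable under conjugation -/

/-- Conjugation preserves absolute summability of the coefficients (`‖conj z‖ = ‖z‖`). [folklore] -/
theorem rre_summable_norm_coeff_conj {A : CSeries}
    (hA : Summable fun a : ℕ →₀ ℕ => ‖MvPowerSeries.coeff a A‖) :
    Summable fun a : ℕ →₀ ℕ => ‖MvPowerSeries.coeff a (MvPowerSeries.map (starRingEnd ℂ) A)‖ :=
  hA.congr fun a => by rw [MvPowerSeries.coeff_map, Complex.norm_conj]

/-- Conjugation fixes `ℚ[z] → ℂ[[z]]`: `conj ∘ (ℚ[z] → ℂ[[z]]) = (ℚ[z] → ℂ[[z]])` (it fixes the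
rational constants and the variables). [folklore] -/
theorem rre_conj_comp_polyToCSeries :
    (MvPowerSeries.map (σ := ℕ) (starRingEnd ℂ)).comp (AyoubRel.polyToCSeries (Rat.castHom ℂ)) =
      AyoubRel.polyToCSeries (Rat.castHom ℂ) := by
  refine MvPolynomial.ringHom_ext (fun q => ?_) (fun l => ?_)
  · simp [AyoubRel.polyToCSeries, MvPolynomial.map_C, MvPolynomial.coe_C]
  · simp [AyoubRel.polyToCSeries, MvPolynomial.map_X, MvPolynomial.coe_X]

/-- **`𝒪_{ℚ-alg}(𝔻̄^∞)` is stable under coefficientwise conjugation**: same variables, same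
majorant, and the conjugate of a polynomial relation over `ℚ[z]` is again one.
[AyoubRelKZRevisited, §1.1; folklore] -/
theorem rre_conj_mem_Oan {G : CSeries} (hG : G ∈ Oan (Rat.castHom ℂ)) :
    MvPowerSeries.map (starRingEnd ℂ) G ∈ Oan (Rat.castHom ℂ) := by
  obtain ⟨⟨m, hm⟩, ⟨r, hr, hs⟩, ⟨P, hP, hPG⟩⟩ := hG
  refine ⟨⟨m, fun a ha => ?_⟩, ⟨r, hr, ?_⟩, ⟨P, hP, ?_⟩⟩
  · rw [MvPowerSeries.coeff_map, hm a ha, map_zero]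
  · refine hs.congr fun a => ?_
    rw [MvPowerSeries.coeff_map, Complex.norm_conj]
  · have key := Polynomial.hom_eval₂ P (AyoubRel.polyToCSeries (Rat.castHom ℂ))
      (MvPowerSeries.map (σ := ℕ) (starRingEnd ℂ)) G
    rw [hPG, map_zero, rre_conj_comp_polyToCSeries] at key
    exact key.symm

/-- The rational constant `q/2` is algebraic over `ℚ` (root of `X - q/2`). [folklore] -/
theorem rre_ratCast_div_two_algebraic (q : ℚ) :
    ∃ p : Polynomial ℚ, p ≠ 0 ∧ Polynomial.eval₂ (Rat.castHom ℂ) ((q : ℂ) / 2) p = 0 := by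
  refine ⟨Polynomial.X - Polynomial.C (q / 2), Polynomial.X_sub_C_ne_zero _, ?_⟩
  rw [Polynomial.eval₂_sub, Polynomial.eval₂_X, Polynomial.eval₂_C, eq_ratCast, Rat.cast_div,
    Rat.cast_ofNat, sub_self]

/-- **The realified series lies in `𝒪_{ℚ-alg}(𝔻̄^∞)`**: `(q/2) • (G + conj G) ∈ 𝒪_{ℚ-alg}(𝔻̄^∞)` for
`G ∈ 𝒪_{ℚ-alg}(𝔻̄^∞)` and `q ∈ ℚ`. [AyoubRelKZRevisited, §1.1; folklore] -/
theorem rre_realPart_mem_Oan {G : CSeries} (hG : G ∈ Oan (Rat.castHom ℂ)) (q : ℚ) :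
    ((q : ℂ) / 2) • (G + MvPowerSeries.map (starRingEnd ℂ) G) ∈ Oan (Rat.castHom ℂ) :=
  AyoubRel.smul_mem_Oan (Rat.castHom ℂ) (rre_ratCast_div_two_algebraic q)
    (AyoubRel.add_mem_Oan (Rat.castHom ℂ) hG (rre_conj_mem_Oan hG))

/-- The Stokes element of the realified series:
`relAC i ((q/2) • (G + conj G)) = (q/2) • (relAC i G + conj (relAC i G))` for `G ∈ 𝒪_{ℚ-alg}(𝔻̄^∞)`.
[AyoubRelKZRevisited, Théorème 1.1 (a); folklore] -/
theorem rre_relAC_realPart {G : CSeries} (hG : G ∈ Oan (Rat.castHom ℂ)) (i : ℕ) (q : ℚ) :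
    relAC i (((q : ℂ) / 2) • (G + MvPowerSeries.map (starRingEnd ℂ) G)) =
      ((q : ℂ) / 2) • (relAC i G + MvPowerSeries.map (starRingEnd ℂ) (relAC i G)) := by
  have hs := AyoubRel.summable_norm_coeff_of_mem_Oan (Rat.castHom ℂ) hG
  rw [AyoubRel.relAC_smul, rre_relAC_add i hs (rre_summable_norm_coeff_conj hs), rre_relAC_conj]

/-! ## The realification lemma -/

/-- **Helper R (realification) for `stub_realStokesForm`.** If `Fc ∈ ℂ[[z]]` has real coefficients
and `Fc = Σⱼ cⱼ • (∂Gⱼ/∂z_{iⱼ} - Gⱼ|_{z_{iⱼ}=1} + Gⱼ|_{z_{iⱼ}=0})` with `cⱼ ∈ ℚ` and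
`Gⱼ ∈ 𝒪_{ℚ-alg}(𝔻̄^∞)`, then the realified series `G'ⱼ := (cⱼ/2) • (Gⱼ + conj Gⱼ)` lie in
`𝒪_{ℚ-alg}(𝔻̄^∞)` and `Fc = Σⱼ (∂G'ⱼ/∂z_{iⱼ} - G'ⱼ|_{z_{iⱼ}=1} + G'ⱼ|_{z_{iⱼ}=0})`
(`Fc = ½ (Fc + conj Fc)`, the Stokes operator being additive and commuting with conjugation).
[AyoubRelKZRevisited, §1.1 and Théorème 1.1 (a); folklore] -/
theorem rsf_realify : ∀ (n : ℕ) (c : Fin n → ℚ) (i : Fin n → ℕ) (G : Fin n → CSeries) (Fc : CSeries), (∀ j, G j ∈ Oan (Rat.castHom ℂ)) → (∀ a : ℕ →₀ ℕ, MvPowerSeries.coeff a Fc = (((MvPowerSeries.coeff a Fc).re : ℝ) : ℂ)) → Fc = ∑ j, (Rat.castHom ℂ (c j)) • relAC (i j) (G j) → (∀ j, (((c j : ℂ) / 2) • (G j + MvPowerSeries.map (starRingEnd ℂ) (G j))) ∈ Oan (Rat.castHom ℂ)) ∧ Fc = ∑ j, relAC (i j) (((c j : ℂ) / 2) • (G j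 + MvPowerSeries.map (starRingEnd ℂ) (G j))) := by
  intro n c i G Fc hG hre hFc
  refine ⟨fun j => rre_realPart_mem_Oan (hG j) (c j), ?_⟩
  rw [Finset.sum_congr rfl fun j _ => rre_relAC_realPart (hG j) (i j) (c j)]
  refine MvPowerSeries.ext fun a => ?_
  -- the coefficient of `Fc` at `a` is real and equals `Σⱼ cⱼ vⱼ`, `vⱼ = coeff_a (relAC (i j) (G j))`
  have hv : MvPowerSeries.coeff a Fc =
      ∑ j, (c j : ℂ) * MvPowerSeries.coeff a (relAC (i j) (G j)) := by
    rw [hFc, map_sum]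
    refine Finset.sum_congr rfl fun j _ => ?_
    rw [MvPowerSeries.coeff_smul, eq_ratCast]
  have hconj : starRingEnd ℂ (MvPowerSeries.coeff a Fc) = MvPowerSeries.coeff a Fc := by
    rw [hre a, Complex.conj_ofReal]
  calc MvPowerSeries.coeff a Fc
      = (MvPowerSeries.coeff a Fc + starRingEnd ℂ (MvPowerSeries.coeff a Fc)) / 2 := by
        rw [hconj]; ring
    _ = ((∑ j, (c j : ℂ) * MvPowerSeries.coeff a (relAC (i j) (G j))) +
          starRingEnd ℂ (∑ j, (c j : ℂ) * MvPowerSeries.coeff a (relAC (i j) (G j)))) / 2 := by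
        rw [hv]
    _ = MvPowerSeries.coeff a (∑ j, ((c j : ℂ) / 2) •
          (relAC (i j) (G j) + MvPowerSeries.map (starRingEnd ℂ) (relAC (i j) (G j)))) := by
        rw [map_sum (starRingEnd ℂ), ← Finset.sum_add_distrib, Finset.sum_div, map_sum]
        refine Finset.sum_congr rfl fun j _ => ?_
        rw [MvPowerSeries.coeff_smul, map_add, MvPowerSeries.coeff_map, map_mul, map_ratCast]
        ring

end Summit.KontsevichZagierPeriods.FurushoPentagon.SectorToKernel
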